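import Literature.AnabelianGeometry.SemiGraphs.TemperedFunctorialityProofs
import Literature.AnabelianGeometry.SemiGraphs.SemiGraphCuspOmission
import Literature.AnabelianGeometry.SemiGraphs.TemperedCoveringsSubgraph
import Literature.AnabelianGeometry.SemiGraphs.TemperedSpecialFibre
import HarnessLib

/-!
# Morphisms of semi-graphs of anabelioids assembled edge by edge, and the packages of the closed edges
# read off a morphism of the maximal subgraphs ([SemiAnbd] Def. 2.1, Rmk. 2.4.2; Cor. 3.11 proof p. 47)

Mochizuki, *Semi-graphs of anabelioids*, Publ. RIMS **42** (2006), §2 Def. 2.1 p. 22 / Rmk. 2.4.2 p. 26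
(morphisms of semi-graphs of anabelioids: maps of underlying semi-graphs with vertex / edge homomorphisms
compatible with the branch homomorphisms up to conjugation) and §3 Cor. 3.11, proof p. 47 ("extends
uniquely to a natural, functorial isomorphism of semi-graphs of anabelioids `G^c[α]_Σ ⥲ G^c[β]_Σ`")
[cite: MochizukiSemiAnbd2006, Cor 3.11 p.47].

CONSTRUCTION file (abc-iut cell, layer L3, sub-DAG SemiAnbd-Cor311, row «Cor311·C∃-LOCAL», seat
abc-iut-w4-d083): the bookkeeping needed to EXTEND a morphism `F₀ : 𝒢|_{𝔾_max} → ℋ|_{ℍ_max}` of the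
maximal subgraphs (cusps omitted) along the cusps.

* `EdgePack V hV e` — a per-edge gluing datum over a vertex map `V` with vertex homomorphisms `hV`:
  target edge, edge homomorphism, injective branch assignment respecting (non-)abutment, and the
  compatibility with the branch homomorphisms up to conjugation (in the re-indexed currency `brHomAt`);
* `EdgePack.hom P` — the morphism `𝒢 → ℋ` assembled from a family of packages (no casts: target edge,
  edge homomorphism and branch images come from the same package); `EdgePack.hom_isIso`;
* `vertexMapMax`, `hVMax`, `packClosed F₀ e he` — the package of a CLOSED edge read off `F₀`
  (`restrict_brHomAt`, `edgeOf_branchMap_max`: re-indexing between `ℋ|_{ℍ_max}` and `ℋ`).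

The packages of the OPEN edges (matched cusps) are in `CuspEdgePack.lean`; the assembly at the special
fibres of Cor. 3.11 in `TemperedSpecialFibreCuspExtension.lean`.  Nothing here takes a side on
[IUTchIII] Cor. 3.12.
-/

open CategoryTheory Topology

noncomputable section

namespace Literature.AnabelianGeometry.SemiGraphs

namespace ProfiniteSemiGraph

universe u

variable {𝒢 ℋ : ProfiniteSemiGraph.{u}}

/-- Per-edge gluing datum for assembling a morphism of semi-graphs of anabelioids edge by edge over a
given vertex map `V` with vertex homomorphisms `hV`: a target edge `f`, an edge homomorphism `η`, an
injective assignment `β` of the branches of `e` to branches of `f` respecting abutments, and the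
compatibility with the branch homomorphisms up to conjugation (Def. 2.1 / Rmk. 2.4.2; used to extend a
morphism along the cusps in the proof of Cor. 3.11 p. 47). [cite: MochizukiSemiAnbd2006, Cor 3.11 p.47] -/
structure EdgePack (V : 𝒢.graph.Vertex → ℋ.graph.Vertex) (hV : ∀ v, 𝒢.Gv v →ₜ* ℋ.Gv (V v))
    (e : 𝒢.graph.Edge) : Type u where
  /-- the target edge -/
  f : ℋ.graph.Edge
  /-- the edge homomorphism -/
  η : 𝒢.Ge e →ₜ* ℋ.Ge f
  /-- the assignment of branches -/
  β : {b : 𝒢.graph.Branch // 𝒢.graph.edgeOf b = e} → {b' : ℋ.graph.Branch // ℋ.graph.edgeOf b' = f}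
  /-- it is injective -/
  β_injective : Function.Injective β
  /-- it respects abutment -/
  β_abuts : ∀ (b : {b : 𝒢.graph.Branch // 𝒢.graph.edgeOf b = e}) (v : 𝒢.graph.Vertex),
    𝒢.graph.abuts b.1 = some v → ℋ.graph.abuts (β b).1 = some (V v)
  /-- it respects non-abutment -/
  β_none : ∀ b : {b : 𝒢.graph.Branch // 𝒢.graph.edgeOf b = e},
    𝒢.graph.abuts b.1 = none → ℋ.graph.abuts (β b).1 = none
  /-- compatibility with the branch homomorphisms up to conjugation -/
  comm : ∀ (b : {b : 𝒢.graph.Branch // 𝒢.graph.edgeOf b = e}) (v : 𝒢.graph.Vertex)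
    (h : 𝒢.graph.abuts b.1 = some v), ∃ g : ℋ.Gv (V v), ∀ x : 𝒢.Ge e,
      hV v (𝒢.brHomAt b.1 v h e b.2 x) =
        g * ℋ.brHomAt (β b).1 (V v) (β_abuts b v h) f (β b).2 (η x) * g⁻¹

namespace EdgePack

variable {V : 𝒢.graph.Vertex → ℋ.graph.Vertex} {hV : ∀ v, 𝒢.Gv v →ₜ* ℋ.Gv (V v)}
  (P : ∀ e, EdgePack V hV e)

/-- Re-indexing the branch assignment along an equality of edges. [cite: MochizukiSemiAnbd2006, Cor 3.11 p.47] -/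
theorem β_val_eq (b : 𝒢.graph.Branch) (e : 𝒢.graph.Edge) (hb : 𝒢.graph.edgeOf b = e) :
    ((P (𝒢.graph.edgeOf b)).β ⟨b, rfl⟩).1 = ((P e).β ⟨b, hb⟩).1 := by
  subst hb; rfl

/-- **The morphism of semi-graphs of anabelioids assembled from per-edge packages.**
[cite: MochizukiSemiAnbd2006, Cor 3.11 p.47] -/
def hom : Hom 𝒢 ℋ where
  base :=
    { vertexMap := V
      edgeMap := fun e => (P e).f
      branchMap := fun b => ((P (𝒢.graph.edgeOf b)).β ⟨b, rfl⟩).1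
      edgeOf_branchMap := fun b => ((P (𝒢.graph.edgeOf b)).β ⟨b, rfl⟩).2
      branchMap_injOn := by
        intro b₁ b₂ he h
        change ((P (𝒢.graph.edgeOf b₁)).β ⟨b₁, rfl⟩).1 = ((P (𝒢.graph.edgeOf b₂)).β ⟨b₂, rfl⟩).1 at h
        rw [β_val_eq P b₁ (𝒢.graph.edgeOf b₂) he] at h
        have := (P (𝒢.graph.edgeOf b₂)).β_injective (Subtype.ext h)
        exact congrArg Subtype.val this
      abuts_branchMap := fun b v h => (P (𝒢.graph.edgeOf b)).β_abuts ⟨b, rfl⟩ v h }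
  hV := hV
  hE e := (P e).η
  comm b v h := by
    obtain ⟨g, hg⟩ := (P (𝒢.graph.edgeOf b)).comm ⟨b, rfl⟩ v h
    refine ⟨g, fun x => ?_⟩
    have h1 := hg x
    rw [brHomAt_rfl] at h1
    rw [h1, brHomAt_apply]

/-- Vertex map of the assembled morphism (definitional). [cite: MochizukiSemiAnbd2006, Cor 3.11 p.47] -/
@[simp] theorem hom_vertexMap (v : 𝒢.graph.Vertex) : (hom P).base.vertexMap v = V v := rfl

/-- Edge map of the assembled morphism (definitional). [cite: MochizukiSemiAnbd2006, Cor 3.11 p.47] -/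
@[simp] theorem hom_edgeMap (e : 𝒢.graph.Edge) : (hom P).base.edgeMap e = (P e).f := rfl

/-- Branch map of the assembled morphism (definitional). [cite: MochizukiSemiAnbd2006, Cor 3.11 p.47] -/
theorem hom_branchMap (b : 𝒢.graph.Branch) :
    (hom P).base.branchMap b = ((P (𝒢.graph.edgeOf b)).β ⟨b, rfl⟩).1 := rfl

/-- Vertex homomorphisms of the assembled morphism (definitional). [cite: MochizukiSemiAnbd2006, Cor 3.11 p.47] -/
@[simp] theorem hom_hV (v : 𝒢.graph.Vertex) : (hom P).hV v = hV v := rfl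

/-- Edge homomorphisms of the assembled morphism (definitional). [cite: MochizukiSemiAnbd2006, Cor 3.11 p.47] -/
@[simp] theorem hom_hE (e : 𝒢.graph.Edge) : (hom P).hE e = (P e).η := rfl

/-- **The assembled morphism is an isomorphism** when the vertex map, the edge assignment and all
vertex / edge homomorphisms are bijective. [cite: MochizukiSemiAnbd2006, Cor 3.11 p.47] -/
theorem hom_isIso (hVb : Function.Bijective V) (hfb : Function.Bijective fun e => (P e).f)
    (hVh : ∀ v, Function.Bijective (hV v)) (hη : ∀ e, Function.Bijective (P e).η) :
    (hom P).IsIso where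
  bijective_vertexMap := hVb
  bijective_edgeMap := hfb
  abuts_none b hb := (P (𝒢.graph.edgeOf b)).β_none ⟨b, rfl⟩ hb
  isLocallyTrivial := ⟨hVh, hη⟩

end EdgePack

/-! ### The packages of the CLOSED edges, read off a morphism of the maximal subgraphs -/

section Closed

variable (F₀ : Hom (𝒢.restrict 𝒢.graph.maximalSubgraph) (ℋ.restrict ℋ.graph.maximalSubgraph))

/-- The vertex map of `F₀` on the vertices of `𝒢` (the maximal subgraph keeps every vertex).
[cite: MochizukiSemiAnbd2006, §1 p.13] -/
def vertexMapMax (v : 𝒢.graph.Vertex) : ℋ.graph.Vertex := (F₀.base.vertexMap ⟨v, Set.mem_univ v⟩).1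

/-- The vertex homomorphisms of `F₀` on the vertices of `𝒢`. [cite: MochizukiSemiAnbd2006, §1 p.13] -/
def hVMax (v : 𝒢.graph.Vertex) : 𝒢.Gv v →ₜ* ℋ.Gv (vertexMapMax F₀ v) := F₀.hV ⟨v, Set.mem_univ v⟩

/-- Re-indexed branch homomorphisms of a restriction are those of the ambient semi-graph of anabelioids.
[cite: MochizukiSemiAnbd2006, Def 2.1 p.24] -/
theorem restrict_brHomAt {K : ℋ.graph.Subgraph} (b' : K.toSemiGraph.Branch) (w : K.toSemiGraph.Vertex)
    (hw : K.toSemiGraph.abuts b' = some w) (f : K.toSemiGraph.Edge) (q : K.toSemiGraph.edgeOf b' = f)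
    (y : ℋ.Ge f.1) :
    (ℋ.restrict K).brHomAt b' w hw f q y =
      ℋ.brHomAt b'.1 w.1 ((K.abuts_eq_some_iff b' w).mp hw) f.1 (congrArg Subtype.val q) y := by
  subst q; rfl

/-- The target edge of a branch of a closed edge under `F₀`, re-indexed.
[cite: MochizukiSemiAnbd2006, §1 p.13] -/
theorem edgeOf_branchMap_max (e : 𝒢.graph.Edge) (he : 𝒢.graph.IsClosedEdge e) (b : 𝒢.graph.Branch)
    (hb : 𝒢.graph.edgeOf b = e) :
    ℋ.graph.edgeOf (F₀.base.branchMap ⟨b, hb.symm ▸ he⟩).1 = (F₀.base.edgeMap ⟨e, he⟩).1 := by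
  subst hb
  exact congrArg Subtype.val (F₀.base.edgeOf_branchMap ⟨b, he⟩)

/-- **The package of a CLOSED edge `e`**: target edge, edge homomorphism and branch assignment read off
`F₀`. [cite: MochizukiSemiAnbd2006, Cor 3.11 p.47] -/
def packClosed (e : 𝒢.graph.Edge) (he : 𝒢.graph.IsClosedEdge e) :
    EdgePack (vertexMapMax F₀) (hVMax F₀) e where
  f := (F₀.base.edgeMap ⟨e, he⟩).1
  η := F₀.hE ⟨e, he⟩
  β b := ⟨(F₀.base.branchMap ⟨b.1, b.2.symm ▸ he⟩).1, edgeOf_branchMap_max F₀ e he b.1 b.2⟩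
  β_injective := by
    intro b₁ b₂ h
    have h' := Subtype.ext_iff.mp h
    have h1 : F₀.base.branchMap ⟨b₁.1, b₁.2.symm ▸ he⟩ = F₀.base.branchMap ⟨b₂.1, b₂.2.symm ▸ he⟩ :=
      Subtype.ext h'
    have he12 : (𝒢.restrict 𝒢.graph.maximalSubgraph).graph.edgeOf ⟨b₁.1, b₁.2.symm ▸ he⟩ =
        (𝒢.restrict 𝒢.graph.maximalSubgraph).graph.edgeOf ⟨b₂.1, b₂.2.symm ▸ he⟩ :=
      Subtype.ext (b₁.2.trans b₂.2.symm)
    have h2 := F₀.base.branchMap_injOn _ _ he12 h1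
    have h3 := congrArg Subtype.val h2
    exact Subtype.ext h3
  β_abuts b v h := by
    have h0 : (𝒢.restrict 𝒢.graph.maximalSubgraph).graph.abuts ⟨b.1, b.2.symm ▸ he⟩ =
        some ⟨v, Set.mem_univ v⟩ :=
      (SemiGraph.Subgraph.abuts_eq_some_iff _ _ _).mpr h
    exact (SemiGraph.Subgraph.abuts_eq_some_iff _ _ _).mp (F₀.base.abuts_branchMap _ _ h0)
  β_none b h0 := by
    have := SemiGraph.isSome_abuts_of_mem_maximalSubgraph (G := 𝒢.graph) (b := b.1) (b.2.symm ▸ he)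
    rw [h0] at this
    exact absurd this (by simp)
  comm b v h := by
    obtain ⟨b, hb⟩ := b
    subst hb
    have h0 : (𝒢.restrict 𝒢.graph.maximalSubgraph).graph.abuts ⟨b, he⟩ = some ⟨v, Set.mem_univ v⟩ :=
      (SemiGraph.Subgraph.abuts_eq_some_iff _ _ _).mpr h
    obtain ⟨g, hg⟩ := F₀.exists_conj ⟨b, he⟩ ⟨v, Set.mem_univ v⟩ h0
      (F₀.base.edgeMap ((𝒢.restrict 𝒢.graph.maximalSubgraph).graph.edgeOf ⟨b, he⟩)) rfl
      (F₀.base.edgeOf_branchMap ⟨b, he⟩)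
    refine ⟨g, fun x => ?_⟩
    have h1 : g * (ℋ.restrict ℋ.graph.maximalSubgraph).brHomAt (F₀.base.branchMap ⟨b, he⟩)
        (F₀.base.vertexMap ⟨v, Set.mem_univ v⟩) (F₀.base.abuts_branchMap _ _ h0)
        (F₀.base.edgeMap ((𝒢.restrict 𝒢.graph.maximalSubgraph).graph.edgeOf ⟨b, he⟩))
        (F₀.base.edgeOf_branchMap ⟨b, he⟩)
        (F₀.hE ((𝒢.restrict 𝒢.graph.maximalSubgraph).graph.edgeOf ⟨b, he⟩) x) * g⁻¹ =
        F₀.hV ⟨v, Set.mem_univ v⟩ ((𝒢.restrict 𝒢.graph.maximalSubgraph).brHom ⟨b, he⟩ ⟨v, _⟩ h0 x) := by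
      have h := hg x
      rw [Hom.hEAt_rfl] at h
      exact h
    rw [restrict_brHomAt] at h1
    rw [brHomAt_rfl]
    exact h1.symm

end Closed

end ProfiniteSemiGraph

end Literature.AnabelianGeometry.SemiGraphs

end
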